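import Summits.KontsevichZagierPeriods.Zeta5Search.LaiSweepShard

/-!
# `κ₃` sweep certificate — shard file 104 of 127 (shards 728–734 of 889)

HONEST FRAMING. Systematic search; no irrationality claim unless certified. This file only checks,
by `decide +kernel`, shards 728–734 of the order-cell sweep of the `κ₃` point `(74, 2180, 444; δ74)`
(engine `LaiSweepEngine`, soundness `LaiSweepJump/Free/Eval/Shard/Kappa3`; a shard is `⟨regime, n,
p, q, p', q', Lo, Up⟩`: `n` cells from `p/q` to `p'/q'` with integer rate sums in `[Lo, Up]`, `K =
128`, `D = 2^40`). It draws NO conclusion: only the capstone `LaiKappa3SweepCert`, which needs all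
127 shard files, does. Kernel cost of this file ≈ 560 cells × 0.3 s.
-/

namespace Summit.KontsevichZagierPeriods.Zeta5Search.Sweep

set_option maxHeartbeats 100000000 in
/-- Shard 728: 80 cells of regime B from `304/381` to `346/433`.
[cite: Lai2024BallRivoal, §4 Lemma 4.3] -/
theorem shard728 :
    Shard.check 128 (2^40)
      ⟨true, 80, 304, 381, 346, 433, 10429880128139, 16193311864312⟩ = true := by
  decide +kernel

set_option maxHeartbeats 100000000 in
/-- Shard 729: 80 cells of regime B from `346/433` to `253/316`.
[cite: Lai2024BallRivoal, §4 Lemma 4.3] -/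
theorem shard729 :
    Shard.check 128 (2^40)
      ⟨true, 80, 346, 433, 253, 316, 13782732195282, 21424462850412⟩ = true := by
  decide +kernel

set_option maxHeartbeats 100000000 in
/-- Shard 730: 80 cells of regime B from `253/316` to `271/338`.
[cite: Lai2024BallRivoal, §4 Lemma 4.3] -/
theorem shard730 :
    Shard.check 128 (2^40)
      ⟨true, 80, 253, 316, 271, 338, 10114729488125, 15739734192276⟩ = true := by
  decide +kernel

set_option maxHeartbeats 100000000 in
/-- Shard 731: 80 cells of regime B from `271/338` to `322/401`.
[cite: Lai2024BallRivoal, §4 Lemma 4.3] -/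
theorem shard731 :
    Shard.check 128 (2^40)
      ⟨true, 80, 271, 338, 322, 401, 10774300250879, 16782679880944⟩ = true := by
  decide +kernel

set_option maxHeartbeats 100000000 in
/-- Shard 732: 80 cells of regime B from `322/401` to `341/424`.
[cite: Lai2024BallRivoal, §4 Lemma 4.3] -/
theorem shard732 :
    Shard.check 128 (2^40)
      ⟨true, 80, 322, 401, 341, 424, 11076432234243, 17271156679941⟩ = true := by
  decide +kernel

set_option maxHeartbeats 100000000 in
/-- Shard 733: 80 cells of regime B from `341/424` to `323/401`.
[cite: Lai2024BallRivoal, §4 Lemma 4.3] -/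
theorem shard733 :
    Shard.check 128 (2^40)
      ⟨true, 80, 341, 424, 323, 401, 10964163088968, 17113945130415⟩ = true := by
  decide +kernel

set_option maxHeartbeats 100000000 in
/-- Shard 734: 80 cells of regime B from `323/401` to `167/207`.
[cite: Lai2024BallRivoal, §4 Lemma 4.3] -/
theorem shard734 :
    Shard.check 128 (2^40)
      ⟨true, 80, 323, 401, 167, 207, 11268662233299, 17607776979953⟩ = true := by
  decide +kernel

/-- The checked shards of this file, in order. [folklore] -/
def shards104 : List (CheckedShard 128 (2^40)) :=
  [⟨_, shard728⟩, ⟨_, shard729⟩, ⟨_, shard730⟩, ⟨_, shard731⟩, ⟨_, shard732⟩,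
    ⟨_, shard733⟩, ⟨_, shard734⟩]

end Summit.KontsevichZagierPeriods.Zeta5Search.Sweep
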